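import Literature.AlgebraicGeometry.GroupSchemes.IdealKernelLayerMap          -- ★ L1–L5: `exists_layerMap`, `isIso_of_comp_eq`, `comp_eq_id_of_comp_eq`
import Literature.AlgebraicGeometry.GroupSchemes.AdmissibleIdealTransport     -- ★ transport of admissible ideals ∕ Frobenius kernel ∕ étaleness along an iso
import HarnessLib

/-!
# The ideal-kernel layer ISOMORPHISM of an equivariant isomorphism `ψ : A ≅ B`, and the transport of admissible ideals of the layers along it
# ([Tate 1997] (1.6)–(1.7), (3.7); [Waterhouse 1979] §2.1; [SGA 3] VII_A 4.1)

Topic `Literature/AlgebraicGeometry/GroupSchemes`; namespace `Literature.AlgebraicGeometry.GroupSchemes.IdealKernelLayerIso`.  THEOREMS ONLY (no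
definition, no named fact, no `instance`, no notation, no `sorry`).  Cell `hodgecm-mathlib` (D-0151), FLOOR 0, P6 «MOD programme» (crux hLiu418 =
stmt-HodgeConjecture-24832, `--supports`, count-neutral): organ **(θ-0) «LAYER ISO OF AN EQUIVARIANT ISOMORPHISM»** of line L2 (socket `stub_DOWN` of the
D-line `Cruxes/HLiu418/Lines/F0_P6a_DatumOfInputs.lean`, rows `smap` ∕ `smap_kerF` (D9 TWIST, SP5) of `SpecReadings`): the group-scheme ISOMORPHISM
`φ : G₀ x̄ ≅ G₀ x̄′` of the `𝔭`-layers that an `𝒪`-equivariant isomorphism of the ambient group schemes `ψ : A_x̄ ≅ A_x̄′` induces, in the PIN CURRENCY of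
the dock (`hι₀G` ∕ `hkerG₀` ∕ `hβ₀G`), together with the transport of ADMISSIBLE ideals (`IsAdm` unfolded: Hopf ∧ corank `r` ∧ `β`-stable), of the
FROBENIUS-KERNEL ideal (`kerFI` unfolded) and of ÉTALENESS (`IdealIsEtale` unfolded) along `φ` — so that the closer՚s `smap τ x̄` is ONE anonymous-constructor
term and `smap_kerF` ONE `Subtype.ext`.  Sequel of ★ `IdealKernelLayerMap` (the layer MAP of a homomorphism; L5 `isIso_of_comp_eq`) and ★
`AdmissibleIdealTransport` (ideals along a GIVEN iso of layers).  HC_CM is proved only modulo the printed citations (2 remaining named inputs hLiu418 24832,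
h413 24833) until rung 0 closes; this file is generic and changes no count.

THE MATHEMATICS ([Tate1997FiniteFlatGroupSchemes] (1.6)–(1.7) p. 122: kernels as group functors; (3.7): orders of finite subgroup schemes; [Waterhouse1979]
§2.1: closed subgroups ↔ Hopf ideals; [SGA3I] VII_A 4.1: functoriality of the relative Frobenius).  In a cartesian monoidal category let `A`, `B` be
monoid objects with families of endomorphisms `α`, `β : O → End`, `𝔭 ⊆ O`, and PINS `ιA : A[𝔭] ↪ A`, `ιB : B[𝔭] ↪ B` (mono homomorphisms with the
universal property `(∀ a ∈ 𝔭, t ≫ α a = 1) ↔ (∃ s, s ≫ ιA = t)`), with endomorphisms `βA`, `βB` of the pins over `α`, `β`.  An ISOMORPHISM `ψ : A ≅ B`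
of monoid objects with `α a ≫ ψ = ψ ≫ β a` for all `a` has `β a ≫ ψ⁻¹ = ψ⁻¹ ≫ α a`; the layer maps `φ` of `ψ` and `φ′` of `ψ⁻¹` (★ L1) are mutually
inverse (★ L5), so `φ : A[𝔭] ≅ B[𝔭]` is an isomorphism of monoid objects OVER `ψ` (`φ ≫ ιB = ιA ≫ ψ`, `φ⁻¹ ≫ ιA = ιB ≫ ψ⁻¹`) intertwining `βA`
and `βB` (★ L3), unique over `ιA ≫ ψ`.  When the pins are AFFINE group schemes over a ring `R`, every invariant of a closed subgroup `H ↪ A[𝔭]` read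
on its Hopf ideal `I` is an invariant of `φ(H)` read on `Γ(φ)⁻¹ I` (★ `AdmissibleIdealTransport`): Hopf, corank, `β`-stability, being the Frobenius
kernel (over a field), étaleness; and `I ↦ Γ(φ)⁻¹ I` is a bijection with inverse `I′ ↦ Γ(φ⁻¹)⁻¹ I′`.

* §1 (any cartesian monoidal category) `comp_inv_eq_inv_comp_of_comp_hom_eq` (the inverse intertwines backwards), **`exists_layerIso`** (the package:
  `φ : GA ≅ GB` over `ψ` both ways, `IsMonHom φ.hom ∧ IsMonHom φ.inv`, equivariance both ways, uniqueness of `φ.hom` over `ιA ≫ ψ.hom` and of `φ.inv`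
  over `ιB ≫ ψ.inv`).
* §2 (schemes over a field, the dock՚s literal pin shape `IsMonHom ι ∧ IsClosedImmersion ι.left`) **`exists_layerIso_of_isClosedImmersion`**.
* §3 (affine group schemes over a ring `R`, a GIVEN iso `φ : G ≅ G'` of layers intertwining `βA`, `βB`) the SUBTYPE PACKAGE of ★ `AdmissibleIdealTransport`:
  **`exists_admissible_transport`** — a map `s` from `{I ∣ Hopf ∧ corank r ∧ βA-stable}` to `{I′ ∣ Hopf ∧ corank r ∧ βB-stable}` with `(s H).1 = Γ(φ)⁻¹ H.1`,
  BIJECTIVE, preserving étaleness of `Spec (Γ ⧸ ·) → Spec R` (iff); over a field of exponential characteristic `p`: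
  **`exists_admissible_transport_frobenius`** — the same `s` carries the Frobenius-kernel ideal `ker Γ(ι_{Ker F^n_G})` to `ker Γ(ι_{Ker F^n_{G'}})`.
* §4 (schemes over a field; everything at once, dock currency) **`exists_layerIso_admissible_transport`** — from the pins, the actions on the pins and an
  equivariant iso `ψ : A ≅ B`: the layer iso `φ` of §2 AND the transport map `s` of §3 along it, with its four laws.
* §5 (ED. 2, any cartesian monoidal category) `pinAction_comp_pinAction_eq_id` (a scalar that is a unit mod `𝔭` acts invertibly on the pin),
  **`exists_layerIso_of_hom_pair`** — the layer iso from a PAIR `u : A → B`, `v : B → A` of equivariant homomorphisms with `u ≫ v = α b`, `v ≫ u = β b`, `b` a unit mod `𝔭`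
  (the return-isogeny shape; §1 is `b = 1`);
* §6 (ED. 2, dock currency) **`exists_layerIso_admissible_transport_of_hom_pair`** — §5 + §3 at once.

## References
* [Tate1997FiniteFlatGroupSchemes] J. Tate, *Finite flat group schemes*, in: Modular Forms and Fermat՚s Last Theorem (1997), (1.6)–(1.7) p. 122, (3.7).
* [Waterhouse1979] W. C. Waterhouse, *Introduction to Affine Group Schemes*, GTM 66 (1979) — §2.1 (closed subgroups and Hopf ideals).
* [GortzWedhorn2023] U. Görtz, T. Wedhorn, *Algebraic Geometry II* (2023) — (27.1.1), §(27.2) (27.2.1), p. 607.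
* [SGA3I] M. Demazure, A. Grothendieck (eds.), *SGA 3, Tome I*, Exp. VII_A §4, 4.1 (relative Frobenius; functoriality).
-/

set_option autoImplicit false

-- Mathlib's `Over`/`Scheme` APIs and the transported group structure on the Frobenius twist are stated across semireducible wrappers
-- (as in ★ `GroupSchemes/*`).
set_option backward.isDefEq.respectTransparency false

universe u

open CategoryTheory CategoryTheory.Limits MonoidalCategory CartesianMonoidalCategory AlgebraicGeometry

noncomputable section

namespace Literature.AlgebraicGeometry.GroupSchemes.IdealKernelLayerIso

open scoped MonObj Obj
open IdealKernelLayerMap AdmIdealTransport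
open Literature.AlgebraicGeometry.Motives AffineGroupScheme
open GroupSchemeKernel (kerι)

/-! ## §1 The layer isomorphism in a cartesian monoidal category -/

section Generic

variable {C : Type*} [Category C] [CartesianMonoidalCategory C]
variable {O : Type*} {σ : Type*} [SetLike σ O]

omit [CartesianMonoidalCategory C] in
/-- The inverse of an isomorphism intertwining `u` and `v` intertwines `v` and `u`: `u ≫ ψ = ψ ≫ v → v ≫ ψ⁻¹ = ψ⁻¹ ≫ u`.
[cite: GortzWedhorn2023, §(27.2) (p. 606)] -/
theorem comp_inv_eq_inv_comp_of_comp_hom_eq {A B : C} (ψ : A ≅ B) {u : A ⟶ A} {v : B ⟶ B} (h : u ≫ ψ.hom = ψ.hom ≫ v) :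
    v ≫ ψ.inv = ψ.inv ≫ u := by
  rw [Iso.comp_inv_eq, Category.assoc, h, Iso.inv_hom_id_assoc]

/-- **THE LAYER ISOMORPHISM (one `obtain`).**  For PINS `ιA : A[𝔭] ↪ A`, `ιB : B[𝔭] ↪ B` (mono homomorphisms with the kernel-of-`𝔭` universal property),
actions-on-the-pins `βA`, `βB` over `α`, `β`, and an ISOMORPHISM of monoid objects `ψ : A ≅ B` with `α a ≫ ψ = ψ ≫ β a` for all `a`, there is an isomorphism
`φ : A[𝔭] ≅ B[𝔭]` with: `φ ≫ ιB = ιA ≫ ψ` and `φ⁻¹ ≫ ιA = ιB ≫ ψ⁻¹`; `φ`, `φ⁻¹` homomorphisms; `βA a ≫ φ = φ ≫ βB a` and `βB a ≫ φ⁻¹ = φ⁻¹ ≫ βA a`; `φ` unique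
over `ιA ≫ ψ` and `φ⁻¹` unique over `ιB ≫ ψ⁻¹` (★ `exists_layerMap` for `ψ` and for `ψ⁻¹`, mutually inverse by ★ `comp_eq_id_of_comp_eq`).
[cite: Tate1997FiniteFlatGroupSchemes, (1.6)–(1.7) p. 122] [cite: GortzWedhorn2023, §(27.2) (p. 607)] -/
theorem exists_layerIso {A B GA GB : C} [MonObj A] [MonObj B] [MonObj GA] [MonObj GB] (𝔭 : σ) (α : O → (A ⟶ A)) (β : O → (B ⟶ B))
    (ιA : GA ⟶ A) (ιB : GB ⟶ B) [IsMonHom ιA] [IsMonHom ιB] [Mono ιA] [Mono ιB]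
    (hkerA : ∀ ⦃T : C⦄ (t : T ⟶ A), (∀ a ∈ 𝔭, t ≫ α a = 1) ↔ ∃ s : T ⟶ GA, s ≫ ιA = t)
    (hkerB : ∀ ⦃T : C⦄ (t : T ⟶ B), (∀ a ∈ 𝔭, t ≫ β a = 1) ↔ ∃ s : T ⟶ GB, s ≫ ιB = t)
    (βA : O → (GA ⟶ GA)) (hβA : ∀ a, βA a ≫ ιA = ιA ≫ α a) (βB : O → (GB ⟶ GB)) (hβB : ∀ a, βB a ≫ ιB = ιB ≫ β a)
    (ψ : A ≅ B) [IsMonHom ψ.hom] (hψ : ∀ a, α a ≫ ψ.hom = ψ.hom ≫ β a) :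
    ∃ φ : GA ≅ GB, φ.hom ≫ ιB = ιA ≫ ψ.hom ∧ φ.inv ≫ ιA = ιB ≫ ψ.inv ∧ IsMonHom φ.hom ∧ IsMonHom φ.inv ∧
      (∀ a, βA a ≫ φ.hom = φ.hom ≫ βB a) ∧ (∀ a, βB a ≫ φ.inv = φ.inv ≫ βA a) ∧
      (∀ φ' : GA ⟶ GB, φ' ≫ ιB = ιA ≫ ψ.hom → φ' = φ.hom) ∧ (∀ φ' : GB ⟶ GA, φ' ≫ ιA = ιB ≫ ψ.inv → φ' = φ.inv) := by
  haveI : IsMonHom ψ.inv := inferInstance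
  have hψ' : ∀ a, β a ≫ ψ.inv = ψ.inv ≫ α a := fun a => comp_inv_eq_inv_comp_of_comp_hom_eq ψ (hψ a)
  obtain ⟨φ, hφ, hmon, hβφ, -, huniq⟩ := exists_layerMap 𝔭 α β ιA ιB hkerA hkerB βA hβA βB hβB ψ.hom hψ
  obtain ⟨φ', hφ', hmon', hβφ', -, huniq'⟩ := exists_layerMap 𝔭 β α ιB ιA hkerB hkerA βB hβB βA hβA ψ.inv hψ'
  exact ⟨⟨φ, φ', comp_eq_id_of_comp_eq ιA ιB ψ.hom_inv_id hφ hφ', comp_eq_id_of_comp_eq ιB ιA ψ.inv_hom_id hφ' hφ⟩,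
    hφ, hφ', hmon, hmon', hβφ, hβφ', huniq, huniq'⟩

end Generic

/-! ## §2 Schemes over a field: the dock՚s literal pin shape (`IsMonHom ι ∧ IsClosedImmersion ι.left`) -/

section Scheme

variable {k : Type u} [Field k] {O : Type*} {σ : Type*} [SetLike σ O]

/-- **THE LAYER ISOMORPHISM OVER A FIELD, dock shape**: as `exists_layerIso`, with the pins given as homomorphic CLOSED IMMERSIONS `ιA.left`, `ιB.left` (the
`hι₀G` shape of the dock; a closed immersion is a monomorphism of `k`-schemes). [cite: Tate1997FiniteFlatGroupSchemes, (1.6)–(1.7) p. 122]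
[cite: GortzWedhorn2023, §(27.2) (p. 607)] -/
theorem exists_layerIso_of_isClosedImmersion {A B GA GB : Over (Spec (.of k))} [MonObj A] [MonObj B] [MonObj GA] [MonObj GB]
    (𝔭 : σ) (α : O → (A ⟶ A)) (β : O → (B ⟶ B)) (ιA : GA ⟶ A) (ιB : GB ⟶ B)
    (hιA : IsMonHom ιA ∧ IsClosedImmersion ιA.left) (hιB : IsMonHom ιB ∧ IsClosedImmersion ιB.left)
    (hkerA : ∀ ⦃T : Over (Spec (.of k))⦄ (t : T ⟶ A), (∀ a ∈ 𝔭, t ≫ α a = 1) ↔ ∃ s : T ⟶ GA, s ≫ ιA = t)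
    (hkerB : ∀ ⦃T : Over (Spec (.of k))⦄ (t : T ⟶ B), (∀ a ∈ 𝔭, t ≫ β a = 1) ↔ ∃ s : T ⟶ GB, s ≫ ιB = t)
    (βA : O → (GA ⟶ GA)) (hβA : ∀ a, βA a ≫ ιA = ιA ≫ α a) (βB : O → (GB ⟶ GB)) (hβB : ∀ a, βB a ≫ ιB = ιB ≫ β a)
    (ψ : A ≅ B) [IsMonHom ψ.hom] (hψ : ∀ a, α a ≫ ψ.hom = ψ.hom ≫ β a) :
    ∃ φ : GA ≅ GB, φ.hom ≫ ιB = ιA ≫ ψ.hom ∧ φ.inv ≫ ιA = ιB ≫ ψ.inv ∧ IsMonHom φ.hom ∧ IsMonHom φ.inv ∧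
      (∀ a, βA a ≫ φ.hom = φ.hom ≫ βB a) ∧ (∀ a, βB a ≫ φ.inv = φ.inv ≫ βA a) ∧
      (∀ φ' : GA ⟶ GB, φ' ≫ ιB = ιA ≫ ψ.hom → φ' = φ.hom) ∧ (∀ φ' : GB ⟶ GA, φ' ≫ ιA = ιB ≫ ψ.inv → φ' = φ.inv) := by
  haveI := hιA.1
  haveI := hιB.1
  haveI : IsClosedImmersion ιA.left := hιA.2
  haveI : IsClosedImmersion ιB.left := hιB.2
  haveI : Mono ιA := Over.mono_of_mono_left ιA
  haveI : Mono ιB := Over.mono_of_mono_left ιB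
  exact exists_layerIso 𝔭 α β ιA ιB hkerA hkerB βA hβA βB hβB ψ hψ

end Scheme

/-! ## §3 The subtype package of ★ `AdmissibleIdealTransport` along a GIVEN isomorphism of affine group schemes -/

section Transport

variable {R : Type u} [CommRing R] {G G' : SchemeOver R} [GrpObj G] [GrpObj G'] [IsAffine G.left] [IsAffine G'.left]

/-- **ADMISSIBLE IDEALS TRANSPORT AS A BIJECTION OF SUBTYPES.**  For an isomorphism of affine group schemes `φ : G ⥲ G'` intertwining two families of
endomorphisms (`βA a ≫ φ = φ ≫ βB a`) and a corank `r`, there is a map `s` from the admissible ideals of `G` (Hopf ∧ `rank_R (Γ(G) ⧸ I) = r` ∧ stable under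
every `Γ(βA a)`) to those of `G'` with `(s H).1 = Γ(φ)⁻¹ H.1` (★ `isHopfIdeal_and_finrank_and_map_le_comap_appTop`), BIJECTIVE (inverse `I′ ↦ Γ(φ⁻¹)⁻¹ I′`,
★ `comap_appTop_inv_comap_appTop_hom` ∕ `comap_appTop_hom_comap_appTop_inv`), and preserving étaleness of the closed subgroup an ideal cuts out
(★ `etale_specOver_quotient_comap_appTop_iff`).  (P6: `AdmSub (G₀ x̄) (β₀ x̄) q → AdmSub (G₀ x̄′) (β₀ x̄′) q` with `IsAdm` ∕ `IdealIsEtale` unfolded.)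
[cite: Tate1997FiniteFlatGroupSchemes, (3.7)] [cite: Waterhouse1979, §2.1] [cite: GortzWedhorn2023, (27.1.1) and §(27.2) (p. 607)] -/
theorem exists_admissible_transport (φ : G ≅ G') [IsMonHom φ.hom] {ρ : Type*} (βA : ρ → (G ⟶ G)) (βB : ρ → (G' ⟶ G'))
    (hβ : ∀ a, βA a ≫ φ.hom = φ.hom ≫ βB a) (r : ℕ) :
    ∃ s : {I : Ideal (Alg G) // I.IsHopfIdeal R ∧ Module.finrank R (Alg G ⧸ I) = r ∧ ∀ a, I.map (βA a).left.appTop.hom ≤ I} →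
          {I' : Ideal (Alg G') // I'.IsHopfIdeal R ∧ Module.finrank R (Alg G' ⧸ I') = r ∧ ∀ a, I'.map (βB a).left.appTop.hom ≤ I'},
      (∀ H, (s H).1 = (H.1.comap φ.hom.left.appTop.hom : Ideal (Alg G'))) ∧ Function.Bijective s ∧
      ∀ H, Etale (Motives.specOver R (Alg G' ⧸ (s H).1)).hom ↔ Etale (Motives.specOver R (Alg G ⧸ H.1)).hom := by
  haveI : IsMonHom φ.inv := inferInstance
  have hβ' : ∀ a, βB a ≫ φ.inv = φ.inv ≫ βA a := fun a => comp_inv_eq_inv_comp_of_comp_hom_eq φ (hβ a)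
  haveI : IsMonHom φ.symm.hom := (inferInstance : IsMonHom φ.inv)
  refine ⟨fun H => ⟨H.1.comap φ.hom.left.appTop.hom, isHopfIdeal_and_finrank_and_map_le_comap_appTop φ βA βB hβ H.2⟩,
    fun H => rfl, ⟨fun H₁ H₂ h => ?_, fun H' => ?_⟩, fun H => etale_specOver_quotient_comap_appTop_iff φ H.1⟩
  · apply Subtype.ext
    have h1 := congrArg (fun J : {I' : Ideal (Alg G') // I'.IsHopfIdeal R ∧ Module.finrank R (Alg G' ⧸ I') = r ∧
        ∀ a, I'.map (βB a).left.appTop.hom ≤ I'} => (J.1.comap φ.inv.left.appTop.hom : Ideal (Alg G))) h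
    simpa only [comap_appTop_inv_comap_appTop_hom] using h1
  · refine ⟨⟨H'.1.comap φ.inv.left.appTop.hom, ?_⟩, Subtype.ext (comap_appTop_hom_comap_appTop_inv φ H'.1)⟩
    exact isHopfIdeal_and_finrank_and_map_le_comap_appTop φ.symm βB βA hβ' H'.2

variable {k : Type u} [Field k] (p : ℕ) [ExpChar k p] (n : ℕ) {H H' : SchemeOver k} [GrpObj H] [GrpObj H'] [IsAffine H.left] [IsAffine H'.left]

/-- **… AND THE FROBENIUS KERNEL GOES TO THE FROBENIUS KERNEL** (over a field of exponential characteristic `p`): the transport `s` of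
`exists_admissible_transport` satisfies, in addition, `H.1 = ker Γ(ι_{Ker F^n_G}) → (s H).1 = ker Γ(ι_{Ker F^n_{G'}})` (★ `comap_appTop_ker_kerι_relFrobeniusOver`;
P6: `smap_kerF` with `kerFI` unfolded, as a `Subtype.ext`). [cite: SGA3I, VII_A 4.1] [cite: Tate1997FiniteFlatGroupSchemes, (3.7)] -/
theorem exists_admissible_transport_frobenius (φ : H ≅ H') [IsMonHom φ.hom] {ρ : Type*} (βA : ρ → (H ⟶ H)) (βB : ρ → (H' ⟶ H'))
    (hβ : ∀ a, βA a ≫ φ.hom = φ.hom ≫ βB a) (r : ℕ) :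
    ∃ s : {I : Ideal (Alg H) // I.IsHopfIdeal k ∧ Module.finrank k (Alg H ⧸ I) = r ∧ ∀ a, I.map (βA a).left.appTop.hom ≤ I} →
          {I' : Ideal (Alg H') // I'.IsHopfIdeal k ∧ Module.finrank k (Alg H' ⧸ I') = r ∧ ∀ a, I'.map (βB a).left.appTop.hom ≤ I'},
      (∀ J, (s J).1 = (J.1.comap φ.hom.left.appTop.hom : Ideal (Alg H'))) ∧ Function.Bijective s ∧
      (∀ J, Etale (Motives.specOver k (Alg H' ⧸ (s J).1)).hom ↔ Etale (Motives.specOver k (Alg H ⧸ J.1)).hom) ∧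
      ∀ J, J.1 = (RingHom.ker (kerι (relFrobeniusOver p n H)).left.appTop.hom : Ideal (Alg H)) →
        (s J).1 = (RingHom.ker (kerι (relFrobeniusOver p n H')).left.appTop.hom : Ideal (Alg H')) := by
  obtain ⟨s, hs, hbij, het⟩ := exists_admissible_transport φ βA βB hβ r
  refine ⟨s, hs, hbij, het, fun J hJ => ?_⟩
  rw [hs J, hJ]
  exact comap_appTop_ker_kerι_relFrobeniusOver p n φ

end Transport

/-! ## §4 Everything at once over a field, in the dock՚s currency -/

section Dock

variable {k : Type u} [Field k] (p : ℕ) [ExpChar k p] (n : ℕ) {O : Type*} {σ : Type*} [SetLike σ O]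

/-- **LAYER ISO + ADMISSIBLE TRANSPORT, DOCK CURRENCY (one `obtain`).**  Over a field `k` of exponential characteristic `p`: group schemes `A`, `B` with
families of endomorphisms `α`, `β : O → End`, `𝔭 ⊆ O`; AFFINE group schemes `GA`, `GB` pinned into `A`, `B` by homomorphic closed immersions `ιA`, `ιB` with the
kernel-of-`𝔭` universal property (`hkerA`, `hkerB`); actions on the pins `βA`, `βB` over `α`, `β` (`hβA`, `hβB`); and an ISOMORPHISM of group schemes
`ψ : A ≅ B` with `α a ≫ ψ = ψ ≫ β a`.  THEN there are the layer isomorphism `φ : GA ≅ GB` over `ψ` (both squares, both homomorphisms, both equivariances)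
AND, for every corank `r`, a BIJECTION `s` from the admissible ideals of `GA` (Hopf ∧ corank `r` ∧ `βA`-stable) to those of `GB` with `(s H).1 = Γ(φ)⁻¹ H.1`,
carrying the Frobenius-kernel ideal `ker Γ(ι_{Ker F^n})` to the Frobenius-kernel ideal and preserving étaleness (iff).  (P6 L2: `ψ` = an
`𝒪_F`-equivariant identification `A_x̄ ≅ A_x̄′` of fibres of the universal abelian scheme, `GA = (𝔡 x̄).G₀`, pins = the dock rows `hι₀G hkerG₀ hβ₀G`;
`smap x̄ := s`, `smap_kerF := Subtype.ext (… rfl)`.) [cite: Tate1997FiniteFlatGroupSchemes, (1.6)–(1.7) p. 122, (3.7)] [cite: Waterhouse1979, §2.1]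
[cite: SGA3I, VII_A 4.1] [cite: GortzWedhorn2023, (27.1.1) and §(27.2) (p. 607)] -/
theorem exists_layerIso_admissible_transport {A B GA GB : SchemeOver k} [GrpObj A] [GrpObj B] [GrpObj GA] [GrpObj GB]
    [IsAffine GA.left] [IsAffine GB.left]
    (𝔭 : σ) (α : O → (A ⟶ A)) (β : O → (B ⟶ B)) (ιA : GA ⟶ A) (ιB : GB ⟶ B)
    (hιA : IsMonHom ιA ∧ IsClosedImmersion ιA.left) (hιB : IsMonHom ιB ∧ IsClosedImmersion ιB.left)
    (hkerA : ∀ ⦃T : SchemeOver k⦄ (t : T ⟶ A), (∀ a ∈ 𝔭, t ≫ α a = 1) ↔ ∃ s : T ⟶ GA, s ≫ ιA = t)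
    (hkerB : ∀ ⦃T : SchemeOver k⦄ (t : T ⟶ B), (∀ a ∈ 𝔭, t ≫ β a = 1) ↔ ∃ s : T ⟶ GB, s ≫ ιB = t)
    (βA : O → (GA ⟶ GA)) (hβA : ∀ a, βA a ≫ ιA = ιA ≫ α a) (βB : O → (GB ⟶ GB)) (hβB : ∀ a, βB a ≫ ιB = ιB ≫ β a)
    (ψ : A ≅ B) [IsMonHom ψ.hom] (hψ : ∀ a, α a ≫ ψ.hom = ψ.hom ≫ β a) (r : ℕ) :
    ∃ (φ : GA ≅ GB) (_ : IsMonHom φ.hom) (_ : IsMonHom φ.inv)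
      (s : {I : Ideal (Alg GA) // I.IsHopfIdeal k ∧ Module.finrank k (Alg GA ⧸ I) = r ∧ ∀ a, I.map (βA a).left.appTop.hom ≤ I} →
           {I' : Ideal (Alg GB) // I'.IsHopfIdeal k ∧ Module.finrank k (Alg GB ⧸ I') = r ∧ ∀ a, I'.map (βB a).left.appTop.hom ≤ I'}),
      φ.hom ≫ ιB = ιA ≫ ψ.hom ∧ φ.inv ≫ ιA = ιB ≫ ψ.inv ∧
      (∀ a, βA a ≫ φ.hom = φ.hom ≫ βB a) ∧ (∀ a, βB a ≫ φ.inv = φ.inv ≫ βA a) ∧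
      (∀ H, (s H).1 = (H.1.comap φ.hom.left.appTop.hom : Ideal (Alg GB))) ∧ Function.Bijective s ∧
      (∀ H, Etale (Motives.specOver k (Alg GB ⧸ (s H).1)).hom ↔ Etale (Motives.specOver k (Alg GA ⧸ H.1)).hom) ∧
      ∀ H, H.1 = (RingHom.ker (kerι (relFrobeniusOver p n GA)).left.appTop.hom : Ideal (Alg GA)) →
        (s H).1 = (RingHom.ker (kerι (relFrobeniusOver p n GB)).left.appTop.hom : Ideal (Alg GB)) := by
  obtain ⟨φ, hφ, hφ', hmon, hmon', hβφ, hβφ', -, -⟩ :=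
    exists_layerIso_of_isClosedImmersion 𝔭 α β ιA ιB hιA hιB hkerA hkerB βA hβA βB hβB ψ hψ
  haveI := hmon
  obtain ⟨s, hs, hbij, het, hfrob⟩ := exists_admissible_transport_frobenius p n φ βA βB hβφ r
  exact ⟨φ, hmon, hmon', s, hφ, hφ', hβφ, hβφ', hs, hbij, het, hfrob⟩

end Dock

/-! ## §5 The layer isomorphism from a PAIR of homomorphisms composing to a scalar that is a unit modulo `𝔭`
(ED. 2, appended; §1–§4 token-identical.)  The return-isogeny shape of line L2 ∕ organ `stub_LAYERISO` and of L3 (f1): downstairs one does not hold an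
isomorphism `A ≅ B` of the ambient group schemes but a PAIR `u : A → B`, `v : B → A` of equivariant homomorphisms with `u ≫ v = ι_A(b)`, `v ≫ u = ι_B(b)` for a
scalar `b` that is a UNIT MODULO `𝔭` (`b′b ≡ 1`); since the pins are killed by `𝔭`, `ι(b)` restricts to an AUTOMORPHISM of each layer, so the layer maps of `u`
and `v` are isomorphisms up to that automorphism ([Tate1997FiniteFlatGroupSchemes] (1.6)–(1.7): kernels as group functors; [MumfordAV1970] §7 Thm. 4 p. 72: the
quotient isogeny and its quasi-inverse `v ∘ u = [n]`).  §1–§4 are the case `b = 1`. -/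

section HomPair

variable {C : Type*} [Category C] [CartesianMonoidalCategory C]
variable {O : Type*} [CommRing O] {σ : Type*} [SetLike σ O]

/-- **A scalar that is a unit modulo `𝔭` acts invertibly on the pin `A[𝔭]`**: if `α` is additive (`α(x+y) = α x · α y`), multiplicative (`α(xy) = α y ≫ α x`) and
unital, the pin `ιA` has the kernel-of-`𝔭` universal property and `βA` acts on it over `α`, then `b′b = 1 + r` with `r ∈ 𝔭` gives `βA b ≫ βA b′ = 𝟙` (`ιA ≫ α(1 + r) =
ιA ≫ (𝟙 · α r) = ιA · 1 = ιA`, ★ `comp_eq_one_of_pin`). [cite: Tate1997FiniteFlatGroupSchemes, (1.6)–(1.7) p. 122] -/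
theorem pinAction_comp_pinAction_eq_id {A GA : C} [MonObj A] (𝔭 : σ) (α : O → (A ⟶ A))
    (hαmul : ∀ x y, α (x * y) = α y ≫ α x) (hαadd : ∀ x y, α (x + y) = α x * α y) (hαone : α 1 = 𝟙 A)
    (ιA : GA ⟶ A) [Mono ιA]
    (hkerA : ∀ ⦃T : C⦄ (t : T ⟶ A), (∀ a ∈ 𝔭, t ≫ α a = 1) ↔ ∃ s : T ⟶ GA, s ≫ ιA = t)
    (βA : O → (GA ⟶ GA)) (hβA : ∀ a, βA a ≫ ιA = ιA ≫ α a) {b b' : O} (hbb' : ∃ r ∈ 𝔭, b' * b = 1 + r) :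
    βA b ≫ βA b' = 𝟙 GA := by
  obtain ⟨r, hr, hr'⟩ := hbb'
  rw [← cancel_mono ιA, Category.assoc, hβA, ← Category.assoc, hβA, Category.assoc, ← hαmul, hr', hαadd, hαone, MonObj.comp_mul,
    Category.comp_id, comp_eq_one_of_pin 𝔭 α ιA hkerA hr, mul_one, Category.id_comp]

/-- **THE LAYER ISOMORPHISM FROM A HOM PAIR (one `obtain`).**  Pins `ιA : A[𝔭] ↪ A`, `ιB : B[𝔭] ↪ B` (mono homomorphisms, kernel-of-`𝔭` universal property) for
additive ∕ multiplicative ∕ unital families `α`, `β : 𝒪 → End`, actions-on-the-pins `βA`, `βB`; homomorphisms `u : A → B`, `v : B → A` intertwining `α`, `β`, with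
`u ≫ v = α b` and `v ≫ u = β b` for a scalar `b` that is a unit modulo `𝔭` (`b′b = 1 + r`, `r ∈ 𝔭`).  THEN there is an isomorphism `φ : A[𝔭] ≅ B[𝔭]` OVER `u`
(`φ ≫ ιB = ιA ≫ u`), with `φ⁻¹ = (layer map of v) ≫ βA b′`, `φ` and `φ⁻¹` homomorphisms, `βA a ≫ φ = φ ≫ βB a` and `βB a ≫ φ⁻¹ = φ⁻¹ ≫ βA a`, `φ` unique over
`ιA ≫ u` (★ L1–L4 for `u` and `v`; `layer(u) ≫ layer(v) = layer(α b) = βA b`, inverted by `pinAction_comp_pinAction_eq_id`).  [cite: Tate1997FiniteFlatGroupSchemes, (1.6)–(1.7) p. 122]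
[cite: MumfordAV1970, §7 Thm. 4 (p. 72)] -/
theorem exists_layerIso_of_hom_pair {A B GA GB : C} [MonObj A] [MonObj B] [MonObj GA] [MonObj GB] (𝔭 : σ) (α : O → (A ⟶ A)) (β : O → (B ⟶ B))
    (hαmul : ∀ x y, α (x * y) = α y ≫ α x) (hαadd : ∀ x y, α (x + y) = α x * α y) (hαone : α 1 = 𝟙 A)
    (hβmul : ∀ x y, β (x * y) = β y ≫ β x) (hβadd : ∀ x y, β (x + y) = β x * β y) (hβone : β 1 = 𝟙 B)
    (ιA : GA ⟶ A) (ιB : GB ⟶ B) [IsMonHom ιA] [IsMonHom ιB] [Mono ιA] [Mono ιB]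
    (hkerA : ∀ ⦃T : C⦄ (t : T ⟶ A), (∀ a ∈ 𝔭, t ≫ α a = 1) ↔ ∃ s : T ⟶ GA, s ≫ ιA = t)
    (hkerB : ∀ ⦃T : C⦄ (t : T ⟶ B), (∀ a ∈ 𝔭, t ≫ β a = 1) ↔ ∃ s : T ⟶ GB, s ≫ ιB = t)
    (βA : O → (GA ⟶ GA)) (hβA : ∀ a, βA a ≫ ιA = ιA ≫ α a) (βB : O → (GB ⟶ GB)) (hβB : ∀ a, βB a ≫ ιB = ιB ≫ β a)
    (u : A ⟶ B) [IsMonHom u] (hu : ∀ a, α a ≫ u = u ≫ β a) (v : B ⟶ A) [IsMonHom v] (hv : ∀ a, β a ≫ v = v ≫ α a)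
    {b b' : O} (huv : u ≫ v = α b) (hvu : v ≫ u = β b) (hbb' : ∃ r ∈ 𝔭, b' * b = 1 + r) :
    ∃ φ : GA ≅ GB, φ.hom ≫ ιB = ιA ≫ u ∧ IsMonHom φ.hom ∧ IsMonHom φ.inv ∧
      (∀ a, βA a ≫ φ.hom = φ.hom ≫ βB a) ∧ (∀ a, βB a ≫ φ.inv = φ.inv ≫ βA a) ∧
      (∀ φ' : GA ⟶ GB, φ' ≫ ιB = ιA ≫ u → φ' = φ.hom) := by
  obtain ⟨φ, hφ, hmon, hβφ, -, huniq⟩ := exists_layerMap 𝔭 α β ιA ιB hkerA hkerB βA hβA βB hβB u hu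
  obtain ⟨ψ, hψ, hmon', hβψ, -, -⟩ := exists_layerMap 𝔭 β α ιB ιA hkerB hkerA βB hβB βA hβA v hv
  haveI := hmon
  haveI := hmon'
  -- `φ ≫ ψ = βA b` and `ψ ≫ φ = βB b` (uniqueness of layer maps over `ιA ≫ u ≫ v = ιA ≫ α b`)
  have hφψ : φ ≫ ψ = βA b := by
    rw [← cancel_mono ιA, comp_comp_eq ιA ιB ιA hφ hψ, huv, hβA]
  have hψφ : ψ ≫ φ = βB b := by
    rw [← cancel_mono ιB, comp_comp_eq ιB ιA ιB hψ hφ, hvu, hβB]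
  -- the scalar `b` is invertible on both pins
  have hbb'' : ∃ r ∈ 𝔭, b * b' = 1 + r := by
    obtain ⟨r, hr, hr'⟩ := hbb'
    exact ⟨r, hr, by rw [mul_comm]; exact hr'⟩
  have hA : βA b ≫ βA b' = 𝟙 GA := pinAction_comp_pinAction_eq_id 𝔭 α hαmul hαadd hαone ιA hkerA βA hβA hbb'
  have hA' : βA b' ≫ βA b = 𝟙 GA := pinAction_comp_pinAction_eq_id 𝔭 α hαmul hαadd hαone ιA hkerA βA hβA hbb''
  have hB : βB b ≫ βB b' = 𝟙 GB := pinAction_comp_pinAction_eq_id 𝔭 β hβmul hβadd hβone ιB hkerB βB hβB hbb'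
  -- `βA b′`, `βB b′` are homomorphisms (layer maps of `α b′`, `β b′` — ★ L2 with `ψ := α b′`, using additivity for `IsMonHom (α b′)`? we avoid it:
  -- `βA b′` is the inverse of the homomorphism `βA b = φ ≫ ψ`)
  haveI hmonAb : IsMonHom (βA b) := hφψ ▸ inferInstance
  haveI hmonAb' : IsMonHom (βA b') := by
    haveI : IsIso (βA b) := ⟨βA b', hA, hA'⟩
    haveI : IsMonHom (asIso (βA b)).hom := hmonAb
    have h : βA b' = (asIso (βA b)).inv := by
      rw [asIso_inv, eq_comm, IsIso.inv_eq_of_hom_inv_id hA]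
    rw [h]
    infer_instance
  refine ⟨⟨φ, ψ ≫ βA b', by rw [← Category.assoc, hφψ, hA], ?_⟩, hφ, hmon, ?_, hβφ, fun a => ?_, huniq⟩
  · -- `(ψ ≫ βA b′) ≫ φ = ψ ≫ φ ≫ βB b′ = βB b ≫ βB b′ = 𝟙`
    rw [Category.assoc, hβφ b', ← Category.assoc, hψφ, hB]
  · change IsMonHom (ψ ≫ βA b')
    infer_instance
  · -- equivariance of the inverse: `βB a ≫ ψ ≫ βA b′ = ψ ≫ βA a ≫ βA b′ = ψ ≫ βA b′ ≫ βA a` (the `βA`'s commute: both are layer maps and `α` is commutative)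
    change βB a ≫ ψ ≫ βA b' = (ψ ≫ βA b') ≫ βA a
    have hcomm : βA a ≫ βA b' = βA b' ≫ βA a := by
      rw [← cancel_mono ιA, Category.assoc, hβA, ← Category.assoc, hβA, Category.assoc, ← hαmul, Category.assoc, hβA, ← Category.assoc, hβA,
        Category.assoc, ← hαmul, mul_comm]
    rw [← Category.assoc, hβψ a, Category.assoc, hcomm, Category.assoc]

end HomPair

/-! ## §6 Hom-pair version over a field in the dock՚s currency, with the admissible transport -/

section DockPair

variable {k : Type u} [Field k] (p : ℕ) [ExpChar k p] (n : ℕ) {O : Type*} [CommRing O] {σ : Type*} [SetLike σ O]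

/-- **LAYER ISO + ADMISSIBLE TRANSPORT FROM A HOM PAIR, DOCK CURRENCY (one `obtain`).**  As `exists_layerIso_admissible_transport` (§4), but the input is a PAIR of
equivariant homomorphisms `u : A → B`, `v : B → A` with `u ≫ v = ι_A(b)`, `v ≫ u = ι_B(b)` for a scalar `b` that is a unit modulo `𝔭` (the reduced return isogeny of a
Serre cover and its cofactor), the pins given as homomorphic closed immersions, the ambient actions additive ∕ multiplicative ∕ unital (the ★ `RingAction` laws `i_add`,
`i_mul`, `i_one`).  Output: the layer iso `φ : GA ≅ GB` over `u` (homomorphisms both ways, equivariant both ways) AND for every corank `r` the bijection `s` of admissible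
ideals along `Γ(φ)` carrying the Frobenius-kernel ideal to the Frobenius-kernel ideal and preserving étaleness (§3). [cite: Tate1997FiniteFlatGroupSchemes, (1.6)–(1.7) p. 122, (3.7)]
[cite: MumfordAV1970, §7 Thm. 4 (p. 72)] [cite: SGA3I, VII_A 4.1] -/
theorem exists_layerIso_admissible_transport_of_hom_pair {A B GA GB : SchemeOver k} [GrpObj A] [GrpObj B] [GrpObj GA] [GrpObj GB]
    [IsAffine GA.left] [IsAffine GB.left]
    (𝔭 : σ) (α : O → (A ⟶ A)) (β : O → (B ⟶ B))
    (hαmul : ∀ x y, α (x * y) = α y ≫ α x) (hαadd : ∀ x y, α (x + y) = α x * α y) (hαone : α 1 = 𝟙 A)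
    (hβmul : ∀ x y, β (x * y) = β y ≫ β x) (hβadd : ∀ x y, β (x + y) = β x * β y) (hβone : β 1 = 𝟙 B)
    (ιA : GA ⟶ A) (ιB : GB ⟶ B)
    (hιA : IsMonHom ιA ∧ IsClosedImmersion ιA.left) (hιB : IsMonHom ιB ∧ IsClosedImmersion ιB.left)
    (hkerA : ∀ ⦃T : SchemeOver k⦄ (t : T ⟶ A), (∀ a ∈ 𝔭, t ≫ α a = 1) ↔ ∃ s : T ⟶ GA, s ≫ ιA = t)
    (hkerB : ∀ ⦃T : SchemeOver k⦄ (t : T ⟶ B), (∀ a ∈ 𝔭, t ≫ β a = 1) ↔ ∃ s : T ⟶ GB, s ≫ ιB = t)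
    (βA : O → (GA ⟶ GA)) (hβA : ∀ a, βA a ≫ ιA = ιA ≫ α a) (βB : O → (GB ⟶ GB)) (hβB : ∀ a, βB a ≫ ιB = ιB ≫ β a)
    (u : A ⟶ B) [IsMonHom u] (hu : ∀ a, α a ≫ u = u ≫ β a) (v : B ⟶ A) [IsMonHom v] (hv : ∀ a, β a ≫ v = v ≫ α a)
    {b b' : O} (huv : u ≫ v = α b) (hvu : v ≫ u = β b) (hbb' : ∃ r ∈ 𝔭, b' * b = 1 + r) (r : ℕ) :
    ∃ (φ : GA ≅ GB) (_ : IsMonHom φ.hom) (_ : IsMonHom φ.inv)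
      (s : {I : Ideal (Alg GA) // I.IsHopfIdeal k ∧ Module.finrank k (Alg GA ⧸ I) = r ∧ ∀ a, I.map (βA a).left.appTop.hom ≤ I} →
           {I' : Ideal (Alg GB) // I'.IsHopfIdeal k ∧ Module.finrank k (Alg GB ⧸ I') = r ∧ ∀ a, I'.map (βB a).left.appTop.hom ≤ I'}),
      φ.hom ≫ ιB = ιA ≫ u ∧
      (∀ a, βA a ≫ φ.hom = φ.hom ≫ βB a) ∧ (∀ a, βB a ≫ φ.inv = φ.inv ≫ βA a) ∧
      (∀ H, (s H).1 = (H.1.comap φ.hom.left.appTop.hom : Ideal (Alg GB))) ∧ Function.Bijective s ∧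
      (∀ H, Etale (Motives.specOver k (Alg GB ⧸ (s H).1)).hom ↔ Etale (Motives.specOver k (Alg GA ⧸ H.1)).hom) ∧
      ∀ H, H.1 = (RingHom.ker (kerι (relFrobeniusOver p n GA)).left.appTop.hom : Ideal (Alg GA)) →
        (s H).1 = (RingHom.ker (kerι (relFrobeniusOver p n GB)).left.appTop.hom : Ideal (Alg GB)) := by
  haveI := hιA.1
  haveI := hιB.1
  haveI : IsClosedImmersion ιA.left := hιA.2
  haveI : IsClosedImmersion ιB.left := hιB.2
  haveI : Mono ιA := Over.mono_of_mono_left ιA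
  haveI : Mono ιB := Over.mono_of_mono_left ιB
  obtain ⟨φ, hφ, hmon, hmon', hβφ, hβφ', -⟩ :=
    exists_layerIso_of_hom_pair 𝔭 α β hαmul hαadd hαone hβmul hβadd hβone ιA ιB hkerA hkerB βA hβA βB hβB u hu v hv huv hvu hbb'
  haveI := hmon
  obtain ⟨s, hs, hbij, het, hfrob⟩ := exists_admissible_transport_frobenius p n φ βA βB hβφ r
  exact ⟨φ, hmon, hmon', s, hφ, hβφ, hβφ', hs, hbij, het, hfrob⟩

end DockPair

end Literature.AlgebraicGeometry.GroupSchemes.IdealKernelLayerIso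

end
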